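import Summits.QuantumAdvantage.QuantumAdvantage.Theorems.LinnikCubicClassGroupsDegreeOnePrimesEscapeRayClassDegOne
import Literature.NumberTheory.GaloisRepresentations.CyclotomicFrobenius
import Literature.NumberTheory.GaloisRepresentations.ArtinLemma
import Mathlib.NumberTheory.Cyclotomic.Basic
import HarnessLib

/-!
# Linnik's theorem for cosets of a congruence class group, XII: the cyclotomic datum — degree-one primes with
# prescribed norm residue `N𝔭 ≡ a (mod m)`

Topic `Summits/QuantumAdvantage/QuantumAdvantage/Theorems`, cell B2b-1 (linnik-cubic), PART A (gen 25); helper toward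
the crux `DegreeOnePrimesEscape` (stmt-QuantumAdvantage-11543) of route `LinnikCubicClassGroups`.  HONEST FRAMING: the
value of this file is a THEOREM (kernel-checked, GRH-free, Siegel-free) — NOT summit progress (the route still rests on
the hypothesis-type target `PureCubicClassNumberHard`).

Let `K` be a number field of degree `n > 1`, `m ≥ 1`, `N = K(ζ_m)`.  The tree's cyclotomic reciprocity law
(`artinKillsRay_frobChar`: the Artin symbol of the Frobenius datum `𝔭 ↦ χ_m(Frob_𝔭) = N𝔭 mod m ∈ H`,
`H = χ_m(Gal(N/K)) ≤ (ℤ/m)ˣ`, kills the narrow ray `mod (m)`; Tate, *Global class field theory* §3.4) makes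
`(H, (m), frobChar)` an abelian Frobenius datum to which the coset Linnik theorems of files VIII–XI apply, with
`Q_{(m)} = |d_K| n^n m^n ≤ (|d_K| m)^{n²+1}`.  Consequences (all with ONE exponent `L = L(n)`):
* `exists_degOnePrime_frobenius_eq_of_isCyclotomicExtension` — **every `σ ∈ Gal(K(ζ_m)/K)` is the Frobenius of a
  prime `𝔭 ∤ m` of `K`, unramified in `K(ζ_m)`, of RESIDUE DEGREE ONE, with `N𝔭 ≤ (|d_K| m)^L` and
  `N𝔭 ≡ χ_m(σ) (mod m)`** — uniformly in `m` and in `K` of degree `n`;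
* `exists_degOnePrime_absNorm_modEq` — **every norm residue class `mod m` that is attained by an ideal of `𝓞 K`
  prime to `m` is attained by a degree-one prime `𝔭 ∤ m` with `N𝔭 ≤ (|d_K| m)^L`** (a statement about `K`
  alone);
* `exists_degOnePrime_absNorm_modEq_one` — in particular there is a degree-one prime `𝔭` of `K` with
  `N𝔭 = p ≡ 1 (mod m)`, `p ≤ (|d_K| m)^L` (Linnik's theorem for the primes `p ≡ 1 (mod m)` having a degree-one
  factor in `K`; for `K/ℚ` Galois these are the primes splitting completely in `K(ζ_m)`, file XIII).
In print the K-uniform least prime ideal in a ray class is Weiss 1983 (Thm 6.4) / Thorner–Zaman 2017 Thm 3.1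
(explicit `D_K^{694} Q^{521} + D_K^{232} Q^{367} n_K^{290 n_K}`); ours is kernel-checked with an inexplicit `L(n)` —
certification value, not a new bound.
References: A. Weiss, J. reine angew. Math. 338 (1983) [Weiss1983]; J. Thorner, A. Zaman, ANT 11 (2017), Thm 3.1
[ThornerZaman2017]; J. Tate, Global class field theory, in Cassels–Fröhlich (1967), Ch. VII §3.4 [TateGCFT1967].
-/

noncomputable section

open Complex Real Set Filter Topology NumberField IsDedekindDomain
open scoped NumberField nonZeroDivisors

namespace Summit.QuantumAdvantage.QuantumAdvantage.Theorems.DegreeOnePrimesEscape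

open Literature.NumberTheory.LFunctions Literature.NumberTheory.LFunctions.NumberField
  Literature.NumberTheory.LFunctions.AbelianDensity Literature.NumberTheory.GaloisRepresentations
open scoped Classical

/-! ### The cyclotomic Frobenius datum satisfies the hypotheses of the coset theorems -/

section Datum

variable {K : Type} [Field K] [NumberField K] {N : Type} [Field N] [NumberField N] [Algebra K N]
  (m : ℕ) [NeZero m] [IsCyclotomicExtension {m} K N]

/-- `frobChar 𝔮 = χ_m|^H (Frob_𝔮)` (the range-restricted cyclotomic character of the chosen Frobenius). -/
theorem frobChar_eq_rangeRestrict (q : HeightOneSpectrum (𝓞 K)) :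
    haveI := isGalois_of_isCyclotomicExtension K N m
    frobChar K N m q = (cycloChar K N m).rangeRestrict (galFrob K N q) :=
  Subtype.ext (by rw [coe_frobChar, MonoidHom.coe_rangeRestrict])

/-- **Non-trivial characters of `H = χ_m(Gal(K(ζ_m)/K))` are non-principal off any `𝔪 ≠ 0`**: the Frobenii at
the primes outside a finite set generate `Gal(K(ζ_m)/K)` (tree `closure_frobenius_eq_top`), and `χ_m` maps
`Gal` onto `H`. -/
theorem frobChar_nonprincipal {𝔪 : Ideal (𝓞 K)} (h𝔪 : 𝔪 ≠ ⊥)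
    (χ : AddChar (Additive (cycloChar K N m).range) ℂ) (hχ : χ ≠ 0) :
    ∃ v : HeightOneSpectrum (𝓞 K), ¬ 𝔪 ≤ v.asIdeal ∧ χ (Additive.ofMul (frobChar K N m v)) ≠ 1 := by
  haveI := isGalois_of_isCyclotomicExtension K N m
  have hcomm := gal_commute_of_isCyclotomicExtension K N m
  by_contra hall
  push Not at hall
  apply hχ
  set B : Set (HeightOneSpectrum (𝓞 K)) :=
    {v | 𝔪 ≤ v.asIdeal} ∪ {v | ¬ Algebra.IsUnramifiedIn (𝓞 N) v.asIdeal} with hB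
  have hBfin : B.Finite := by
    refine Set.Finite.union ?_ (finite_setOf_not_isUnramifiedIn K N)
    refine (Ideal.finite_factors h𝔪).subset fun v hv ↦ ?_
    exact Ideal.dvd_iff_le.mpr hv
  have hgen := closure_frobenius_eq_top hcomm hBfin
  -- the character kills the image of every element of `Gal(N/K)`
  have hker : ∀ τ : N ≃ₐ[K] N, χ (Additive.ofMul ((cycloChar K N m).rangeRestrict τ)) = 1 := by
    intro τ
    have hτ : τ ∈ Subgroup.closure {φ : N ≃ₐ[K] N | ∃ v : HeightOneSpectrum (𝓞 K), v ∉ B ∧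
        ∃ Q ∈ v.asIdeal.primesOver (𝓞 N), IsArithFrobAt (𝓞 K) φ Q} := by
      rw [hgen]; exact Subgroup.mem_top τ
    induction hτ using Subgroup.closure_induction with
    | mem φ hφ =>
      obtain ⟨v, hvB, Q, hQ, hφQ⟩ := hφ
      simp only [hB, Set.mem_union, Set.mem_setOf_eq, not_or, not_not] at hvB
      rw [eq_galFrob hcomm hvB.2 hQ hφQ, ← frobChar_eq_rangeRestrict]
      exact hall v hvB.1
    | one => rw [map_one, ofMul_one, AddChar.map_zero_eq_one]
    | mul φ φ' _ _ h1 h2 => rw [map_mul, ofMul_mul, AddChar.map_add_eq_mul, h1, h2, one_mul]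
    | inv φ _ h1 => rw [map_inv, ofMul_inv, AddChar.map_neg_eq_inv, h1, inv_one]
  refine DFunLike.ext χ 0 fun a ↦ ?_
  rw [AddChar.zero_apply]
  obtain ⟨τ, hτ⟩ := MonoidHom.rangeRestrict_surjective (cycloChar K N m) (Additive.toMul a)
  have : a = Additive.ofMul ((cycloChar K N m).rangeRestrict τ) := by rw [hτ, ofMul_toMul]
  rw [this]
  exact hker τ

omit [NeZero m] [IsCyclotomicExtension {m} K N] in
/-- `N((m)) = m^{[K:ℚ]}`. -/
theorem absNorm_span_natCast : Ideal.absNorm (Ideal.span {(m : 𝓞 K)}) = m ^ Module.finrank ℚ K := by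
  rw [Ideal.absNorm_span_singleton, ← map_natCast (algebraMap ℤ (𝓞 K)) m, Algebra.norm_algebraMap,
    RingOfIntegers.rank, Int.natAbs_pow, Int.natAbs_natCast]

omit [IsCyclotomicExtension {m} K N] in
/-- `(m) ≠ 0`. -/
theorem span_natCast_ne_bot : (Ideal.span {(m : 𝓞 K)} : Ideal (𝓞 K)) ≠ ⊥ := by
  rw [Ne, Ideal.span_singleton_eq_bot]
  exact_mod_cast NeZero.ne m

omit [NeZero m] [IsCyclotomicExtension {m} K N] in
/-- **`Q_{(m)} = |d_K| n^n m^n`.** -/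
theorem rayCondQ_span_natCast :
    rayCondQ K (Ideal.span {(m : 𝓞 K)}) =
      |(NumberField.discr K : ℝ)| * (Module.finrank ℚ K : ℝ) ^ Module.finrank ℚ K * (m : ℝ) ^ Module.finrank ℚ K := by
  rw [rayCondQ, ThornerZaman.condQn, absNorm_span_natCast]
  push_cast
  ring

omit [IsCyclotomicExtension {m} K N] in
/-- **`Q_{(m)} ≤ (|d_K| m)^{n²+1}`** for `n = [K:ℚ] > 1` (`n^n ≤ 2^{n²} < |d_K|^{n²}`, Minkowski `|d_K| > 2`). -/
theorem rayCondQ_span_natCast_le (hK : 1 < Module.finrank ℚ K) :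
    rayCondQ K (Ideal.span {(m : 𝓞 K)}) ≤
      (|(NumberField.discr K : ℝ)| * m) ^ (Module.finrank ℚ K ^ 2 + 1) := by
  set n := Module.finrank ℚ K with hn
  set D : ℝ := |(NumberField.discr K : ℝ)| with hD
  have hD2 : 2 < D := by
    have h := NumberField.abs_discr_gt_two hK
    rw [hD, ← Int.cast_abs]; exact_mod_cast h
  have hD0 : 0 ≤ D := by linarith
  have hm1 : (1 : ℝ) ≤ m := by exact_mod_cast NeZero.one_le
  have hnD : (n : ℝ) ≤ D ^ n := by
    have h1 : (n : ℝ) < 2 ^ n := by exact_mod_cast Nat.lt_two_pow_self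
    have h2 : (2 : ℝ) ^ n ≤ D ^ n := pow_le_pow_left₀ (by norm_num) hD2.le n
    linarith
  have hnn : (n : ℝ) ^ n ≤ D ^ (n ^ 2) := by
    calc (n : ℝ) ^ n ≤ (D ^ n) ^ n := pow_le_pow_left₀ (Nat.cast_nonneg n) hnD n
      _ = D ^ (n ^ 2) := by rw [← pow_mul, sq]
  have hmn : (m : ℝ) ^ n ≤ (m : ℝ) ^ (n ^ 2 + 1) :=
    pow_le_pow_right₀ hm1 (by nlinarith [Nat.zero_le n])
  rw [rayCondQ_span_natCast m, ← hn, ← hD]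
  calc D * (n : ℝ) ^ n * (m : ℝ) ^ n ≤ D * D ^ (n ^ 2) * (m : ℝ) ^ (n ^ 2 + 1) := by
        gcongr
    _ = (D * m) ^ (n ^ 2 + 1) := by rw [mul_pow, pow_succ]; ring

omit [IsCyclotomicExtension {m} K N] in
/-- The threshold conversion `Q_{(m)}^L ≤ (|d_K| m)^{(n²+1)L}` for `L ≥ 0`. -/
theorem rayCondQ_span_natCast_rpow_le (hK : 1 < Module.finrank ℚ K) {L : ℝ} (hL : 0 ≤ L) :
    rayCondQ K (Ideal.span {(m : 𝓞 K)}) ^ L ≤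
      (|(NumberField.discr K : ℝ)| * m) ^ (((Module.finrank ℚ K ^ 2 + 1 : ℕ) : ℝ) * L) := by
  have hR12 : (12 : ℝ) ≤ rayCondQ K (Ideal.span {(m : 𝓞 K)}) := twelve_le_rayCondQ hK (span_natCast_ne_bot m)
  have hR0 : 0 ≤ rayCondQ K (Ideal.span {(m : 𝓞 K)}) := by linarith
  have hb0 : 0 ≤ |(NumberField.discr K : ℝ)| * m := by positivity
  rw [Real.rpow_mul hb0, Real.rpow_natCast]
  exact Real.rpow_le_rpow hR0 (rayCondQ_span_natCast_le m hK) hL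

omit [NumberField N] in
/-- **`|H| ≤ m ≤ Q_{(m)}⁴`** (`H ≤ (ℤ/m)ˣ`). -/
theorem natCard_range_cycloChar_le (hK : 1 < Module.finrank ℚ K) :
    (Nat.card (cycloChar K N m).range : ℝ) ≤ rayCondQ K (Ideal.span {(m : 𝓞 K)}) ^ (4 : ℕ) := by
  have h1 : Nat.card (cycloChar K N m).range ≤ Nat.card (ZMod m)ˣ :=
    Nat.card_le_card_of_injective _ (cycloChar K N m).range.subtype_injective
  have h2 : Nat.card (ZMod m)ˣ ≤ Nat.card (ZMod m) :=
    Nat.card_le_card_of_injective (Units.val : (ZMod m)ˣ → ZMod m) Units.val_injective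
  rw [Nat.card_zmod] at h2
  have h3 : (Nat.card (cycloChar K N m).range : ℝ) ≤ m := by exact_mod_cast h1.trans h2
  have hR12 : (12 : ℝ) ≤ rayCondQ K (Ideal.span {(m : 𝓞 K)}) := twelve_le_rayCondQ hK (span_natCast_ne_bot m)
  set n := Module.finrank ℚ K with hn
  set D : ℝ := |(NumberField.discr K : ℝ)| with hD
  have hD2 : 2 < D := by
    have h := NumberField.abs_discr_gt_two hK
    rw [hD, ← Int.cast_abs]; exact_mod_cast h
  have hm1 : (1 : ℝ) ≤ m := by exact_mod_cast NeZero.one_le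
  have h4 : (m : ℝ) ≤ rayCondQ K (Ideal.span {(m : 𝓞 K)}) := by
    rw [rayCondQ_span_natCast m, ← hn, ← hD]
    have hn1 : (1 : ℝ) ≤ (n : ℝ) ^ n := one_le_pow₀ (by exact_mod_cast hK.le)
    have hmn : (m : ℝ) ≤ (m : ℝ) ^ n := le_self_pow₀ hm1 (by omega)
    calc (m : ℝ) = 1 * 1 * m := by ring
      _ ≤ D * (n : ℝ) ^ n * (m : ℝ) ^ n := by gcongr; linarith
  calc (Nat.card (cycloChar K N m).range : ℝ) ≤ rayCondQ K (Ideal.span {(m : 𝓞 K)}) := h3.trans h4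
    _ ≤ rayCondQ K (Ideal.span {(m : 𝓞 K)}) ^ (4 : ℕ) := le_self_pow₀ (by linarith) (by norm_num)

/-- A prime `𝔮 ∌ m` of `K` is unramified in `K(ζ_m)` (tree `ArtinLemma.isUnramifiedAt_of_isCyclotomicExtension`:
`m ∈ 𝔇_{K(ζ_m)/K}`). -/
theorem isUnramifiedIn_of_natCast_not_mem {v : HeightOneSpectrum (𝓞 K)} (hm : (m : 𝓞 K) ∉ v.asIdeal) :
    Algebra.IsUnramifiedIn (𝓞 N) v.asIdeal := by
  intro Q hQ hover
  have hmQ : (m : 𝓞 N) ∉ Q := fun h ↦ hm (by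
    rw [hover.over, Ideal.under_def, Ideal.mem_comap, map_natCast]
    exact h)
  exact ArtinLemma.isUnramifiedAt_of_isCyclotomicExtension Q hmQ

omit [NumberField K] [NeZero m] [IsCyclotomicExtension {m} K N] in
/-- An ideal coprime to `(m)` has no prime factor containing `m`. -/
theorem natCast_not_mem_of_dvd_of_isCoprime {I : Ideal (𝓞 K)} (hI : IsCoprime I (Ideal.span {(m : 𝓞 K)}))
    (v : HeightOneSpectrum (𝓞 K)) (hv : v.asIdeal ∣ I) : (m : 𝓞 K) ∉ v.asIdeal := by
  intro hmv
  have h1 : I ≤ v.asIdeal := Ideal.le_of_dvd hv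
  have h2 : Ideal.span {(m : 𝓞 K)} ≤ v.asIdeal := (Ideal.span_singleton_le_iff_mem _).mpr hmv
  have htop : (⊤ : Ideal (𝓞 K)) ≤ v.asIdeal := by
    rw [← Ideal.isCoprime_iff_sup_eq.mp hI]
    exact sup_le h1 h2
  exact v.isPrime.ne_top (top_le_iff.mp htop)

end Datum

/-! ### The Chebotarev–Linnik theorem for `K(ζ_m)/K` with degree-one primes -/

/-- **Linnik–Chebotarev for cyclotomic extensions, degree-one primes** (see the module docstring): for `n > 1` there is
`L = L(n) > 0` such that for every number field `K` of degree `n`, every `m ≥ 1`, every `m`-th cyclotomic extension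
`N = K(ζ_m)` and every `σ ∈ Gal(N/K)` there is a prime `𝔭 ∌ m` of `K`, unramified in `N`, whose norm is a rational
prime `p ≤ (|d_K| m)^L` with `p ≡ χ_m(σ) (mod m)`, all of whose Frobenii equal `σ`.
[cite: Weiss1983, Theorem 6.4] [cite: ThornerZaman2017, Theorem 3.1] [cite: TateGCFT1967, Ch. VII §3.4] -/
theorem exists_degOnePrime_frobenius_eq_of_isCyclotomicExtension (n : ℕ) (hn : 1 < n) :
    ∃ L : ℝ, 0 < L ∧ ∀ (K : Type) [Field K] [NumberField K], Module.finrank ℚ K = n →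
    ∀ (m : ℕ) [NeZero m] (N : Type) [Field N] [NumberField N] [Algebra K N] [IsCyclotomicExtension {m} K N],
      ∀ σ : N ≃ₐ[K] N, ∃ v : HeightOneSpectrum (𝓞 K), (m : 𝓞 K) ∉ v.asIdeal ∧
        Algebra.IsUnramifiedIn (𝓞 N) v.asIdeal ∧
        (Ideal.absNorm v.asIdeal).Prime ∧
        (Ideal.absNorm v.asIdeal : ℝ) ≤ (|(NumberField.discr K : ℝ)| * m) ^ L ∧
        ((Ideal.absNorm v.asIdeal : ℕ) : ZMod m) = ((cycloChar K N m σ : (ZMod m)ˣ) : ZMod m) ∧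
        ∀ Q ∈ v.asIdeal.primesOver (𝓞 N), ∀ φ : N ≃ₐ[K] N, IsArithFrobAt (𝓞 K) φ Q → φ = σ := by
  obtain ⟨L, hL, h⟩ := exists_degOnePrime_fiber_absNorm_le n hn
  refine ⟨((n ^ 2 + 1 : ℕ) : ℝ) * L, by positivity, fun K _ _ hKn m _ N _ _ _ _ σ ↦ ?_⟩
  haveI := isGalois_of_isCyclotomicExtension K N m
  have hcomm := gal_commute_of_isCyclotomicExtension K N m
  have hK : 1 < Module.finrank ℚ K := by rw [hKn]; exact hn
  set 𝔪 : Ideal (𝓞 K) := Ideal.span {(m : 𝓞 K)} with h𝔪def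
  have h𝔪 : 𝔪 ≠ ⊥ := span_natCast_ne_bot m
  obtain ⟨v, hmv, hfv, hprime, hle⟩ := h K hKn (cycloChar K N m).range 𝔪 (frobChar K N m) h𝔪
    (artinKillsRay_frobChar K N m le_rfl) (fun χ hχ ↦ frobChar_nonprincipal m h𝔪 χ hχ)
    (natCard_range_cycloChar_le m hK) ((cycloChar K N m).rangeRestrict σ)
  have hm : (m : 𝓞 K) ∉ v.asIdeal := by rwa [h𝔪def, Ideal.span_singleton_le_iff_mem] at hmv
  have hunr : Algebra.IsUnramifiedIn (𝓞 N) v.asIdeal := isUnramifiedIn_of_natCast_not_mem m hm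
  have hFrob : galFrob K N v = σ := by
    apply cycloChar_injective K N m
    have := congrArg (fun x : (cycloChar K N m).range ↦ (x : (ZMod m)ˣ)) hfv
    simpa only [coe_frobChar, MonoidHom.coe_rangeRestrict] using this
  refine ⟨v, hm, hunr, hprime, ?_, ?_, fun Q hQ φ hφ ↦ (eq_galFrob hcomm hunr hQ hφ).trans hFrob⟩
  · have := rayCondQ_span_natCast_rpow_le (K := K) m hK hL.le
    rw [hKn] at this
    exact hle.trans this
  · rw [← hFrob]
    exact (val_cycloChar_galFrob K N m v hm).symm

/-! ### Degree-one primes with prescribed norm residue `mod m` -/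

/-- **Every norm residue `mod m` of an ideal prime to `m` is the norm residue of a small degree-one prime** (see the
module docstring): for `n > 1` there is `L = L(n) > 0` such that for every number field `K` of degree `n`, every
`m ≥ 1` and every nonzero ideal `𝔞` of `𝓞 K` coprime to `(m)` there is a prime `𝔭 ∌ m` of `K` whose norm is a
rational prime `p ≡ N𝔞 (mod m)` with `p ≤ (|d_K| m)^L`. [cite: Weiss1983, Theorem 6.4]
[cite: ThornerZaman2017, Theorem 3.1] [cite: TateGCFT1967, Ch. VII §3.4 (Corollary)] -/
theorem exists_degOnePrime_absNorm_modEq (n : ℕ) (hn : 1 < n) :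
    ∃ L : ℝ, 0 < L ∧ ∀ (K : Type) [Field K] [NumberField K], Module.finrank ℚ K = n →
    ∀ m : ℕ, m ≠ 0 → ∀ I : Ideal (𝓞 K), I ≠ ⊥ → IsCoprime I (Ideal.span {(m : 𝓞 K)}) →
      ∃ v : HeightOneSpectrum (𝓞 K), (m : 𝓞 K) ∉ v.asIdeal ∧ (Ideal.absNorm v.asIdeal).Prime ∧
        Ideal.absNorm v.asIdeal ≡ Ideal.absNorm I [MOD m] ∧
        (Ideal.absNorm v.asIdeal : ℝ) ≤ (|(NumberField.discr K : ℝ)| * m) ^ L := by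
  obtain ⟨L, hL, h⟩ := exists_degOnePrime_frobenius_eq_of_isCyclotomicExtension n hn
  refine ⟨L, hL, fun K _ _ hKn m hm0 I hI hcop ↦ ?_⟩
  haveI : NeZero m := ⟨hm0⟩
  set N : Type := CyclotomicField m K
  haveI := isGalois_of_isCyclotomicExtension K N m
  -- the class of `𝔞` in `H`: its cyclotomic character is `N𝔞 mod m`
  set σ₀ : (cycloChar K N m).range := artinSymbol (frobChar K N m) I with hσ₀
  have hσ₀val : ((σ₀ : (ZMod m)ˣ) : ZMod m) = (Ideal.absNorm I : ZMod m) :=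
    val_artinSymbol_frobChar K N m hI (natCast_not_mem_of_dvd_of_isCoprime m hcop)
  obtain ⟨τ, hτ⟩ := σ₀.2
  obtain ⟨v, hm, -, hprime, hle, hres, -⟩ := h K hKn m N τ
  refine ⟨v, hm, hprime, ?_, hle⟩
  rw [hτ, hσ₀val] at hres
  exact (ZMod.natCast_eq_natCast_iff _ _ _).mp hres

/-- **Linnik's theorem for degree-one primes with `N𝔭 ≡ 1 (mod m)`**: for `n > 1` there is `L = L(n) > 0` such that
every number field `K` of degree `n` has, for every `m ≥ 1`, a prime `𝔭 ∌ m` whose norm is a rational prime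
`p ≡ 1 (mod m)` with `p ≤ (|d_K| m)^L`. [cite: Weiss1983, Theorem 6.4] [cite: ThornerZaman2017, Theorem 3.1] -/
theorem exists_degOnePrime_absNorm_modEq_one (n : ℕ) (hn : 1 < n) :
    ∃ L : ℝ, 0 < L ∧ ∀ (K : Type) [Field K] [NumberField K], Module.finrank ℚ K = n →
    ∀ m : ℕ, m ≠ 0 →
      ∃ v : HeightOneSpectrum (𝓞 K), (m : 𝓞 K) ∉ v.asIdeal ∧ (Ideal.absNorm v.asIdeal).Prime ∧
        Ideal.absNorm v.asIdeal ≡ 1 [MOD m] ∧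
        (Ideal.absNorm v.asIdeal : ℝ) ≤ (|(NumberField.discr K : ℝ)| * m) ^ L := by
  obtain ⟨L, hL, h⟩ := exists_degOnePrime_absNorm_modEq n hn
  refine ⟨L, hL, fun K _ _ hKn m hm0 ↦ ?_⟩
  have hcop : IsCoprime (⊤ : Ideal (𝓞 K)) (Ideal.span {(m : 𝓞 K)}) := by
    rw [← Ideal.one_eq_top]; exact isCoprime_one_left
  obtain ⟨v, hm, hprime, hres, hle⟩ := h K hKn m hm0 ⊤ top_ne_bot hcop
  exact ⟨v, hm, hprime, by simpa only [Ideal.absNorm_top] using hres, hle⟩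

end Summit.QuantumAdvantage.QuantumAdvantage.Theorems.DegreeOnePrimesEscape

end
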